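import Summits.HubbardSuperconductivity.HubbardLadder.PairSourceEnergySlackTTPrime
import Literature.MathematicalPhysics.QuantumLattice.HubbardNNNHoppingWindowCertificate
import HarnessLib

/-!
# Route #2 at `t'`, THERMODYNAMIC-LIMIT ROWS FORM: a certified TL upper row `e(1,t',U,n) ≤ e⁺` and a
# sourced lower row `e⁻L² ≤ E₀(A_L(h))` give `liminf_k σ_d²(2k) ≤ (e⁺ − μn − e⁻)²/(2h²)`

HONEST FRAMING: this file certifies NO number and makes no claim on `H`/`H₀` or on the CUPRATE QUESTION; the
two rows are HYPOTHESES of the stated shape (no instance constructed or claimed). Cell hubbard-cq (LADDER rung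
CQ at `(U, δ, t') = (8, 1/8, −1/4)`, ABSENT/BOUNDED branch), seat hubbard-cq-obsth-3; sequel of
`PairSourceEnergySlackTTPrime.lean` (this seat: the Koma–Tasaki Thm 2.2 eigenvector inequality at `t'`).

Why this form: the certified energies of record at `t' ≠ 0` are THERMODYNAMIC-LIMIT rows
`energyDensityTT' 1 t' U n ≤ e⁺` (the shape of `Bounds.tlUpperTI_U8_tp0_n7o8_16k_ti4ds` at `t' = 0`; the mbsolver
`(8, 7/8, −1/4)` window), not torus-family sector bounds with exact density; and the admissible ground-state
sequences of the CUPRATE QUESTION carry `N_L = rectN n L = 2⌊nL²/2⌋` electrons (rounded). Both the rounding and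
the passage from the TL row to finite tori are absorbed by the limit
`E_{(ℤ/Lℤ)²}(rectN n L)/L² → e(1,t',U,n)` (`tendsto_energyDensityTT'_torus`) and `rectN n L/L² → n`
(`tendsto_rectN_div_sq`): for every `s' > s := e⁺ − μn − e⁻` the sourced slack is eventually `≤ s'L²`, so
§1 gives `liminf ≤ s'²/(2h²)` for all `s' > s`, i.e. `≤ s²/(2h²)`.

* §1 `liminf_dWaveOrderParamSq_le_of_eventually_slack_TT'` — if on every even side `L ≥ L₁` every unit
  `(N_L, S^z = 0)`-sector ground state of `hubbardTorusTT' L 1 t' U` has sourced slack `≤ sL²` (`s, h > 0`), then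
  `liminf_k σ_d²(2k) ≤ s²/(2h²)` along every admissible sequence.
* §2 `liminf_dWaveOrderParamSq_le_of_tlRows_TT'` — THE TL ROWS FORM (statement in the title), for `U ≥ 0`,
  `0 ≤ n < 2`, `h > 0`, any real `μ`, `N_L = rectN n L`.

References: T. Koma, H. Tasaki, J. Stat. Phys. 76 (1994) 745, Theorem 2.2; D. Ruelle, *Statistical Mechanics*
(1969) §3.3 (thermodynamic limit of the ground-state energy density); H. Tasaki, H. Watanabe (2021), discussion
after eq. (11); H. Xu et al., Science 384 (2024) eadh7691, eq. (1).
-/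

noncomputable section

namespace Summit.HubbardSuperconductivity.HubbardLadder

open Matrix Filter Literature.Probability.LatticeModels
open Literature.MathematicalPhysics.QuantumLattice ThermodynamicLimit
open scoped ComplexOrder Topology

/-! ## §1 From an eventual slack bound to the `liminf` ceiling -/

/-- **Eventual sourced slack ⇒ pair-LRO ceiling.** If for some `L₁` every unit `(N_L, S^z = 0)`-sector ground
state `ψ` of `hubbardTorusTT' L 1 t' U` on every EVEN side `L ≥ L₁` satisfies
`E_{N_L}^{t'}(L) − μN_L − E₀(dWaveSourceTorusTT' L t' U μ h) ≤ sL²` (`h, s > 0`), then along every admissible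
sequence `liminf_k σ_d²(2k) ≤ s²/(2h²)`. [cite: KomaTasaki1994, Theorem 2.2]
[cite: TasakiWatanabe2021, discussion after eq. (11)] -/
theorem liminf_dWaveOrderParamSq_le_of_eventually_slack_TT' (t' U μ h s : ℝ) (hh : 0 < h) (hs : 0 < s)
    (N : ℕ → ℕ) (L₁ : ℕ)
    (hslack : ∀ (L : ℕ) [NeZero L], L₁ ≤ L → Even L → ∀ ψ : Fock (Orb (FermionTorus 2 L)),
      star ψ ⬝ᵥ ψ = 1 → IsGroundStateInSector (hubbardTorusTT' L 1 t' U) (N L) 0 ψ →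
        (hubbardTorusTT' L 1 t' U).minEnergyOn (szSector (N L) 0) - μ * (N L) -
          (dWaveSourceTorusTT' L t' U μ h).groundEnergy ≤ s * (L : ℝ) ^ 2)
    (ψ : ∀ L, Fock (Orb (FermionTorus 2 L)))
    (hψ : ∀ L, Even L → star (ψ L) ⬝ᵥ ψ L = 1 ∧
      IsGroundStateInSector (hubbardTorusTT' L 1 t' U) (N L) 0 (ψ L)) :
    liminf (fun k => dWaveOrderParamSq ψ k) atTop ≤ s ^ 2 / (2 * h ^ 2) := by
  obtain ⟨C, L₀, hC0, hC⟩ := pairFieldDensity_le_of_sourcedSlack_TT' t' U μ h s hh hs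
  have hcast : Tendsto (fun k : ℕ => (((2 * k : ℕ) : ℝ))) atTop atTop := by
    refine tendsto_natCast_atTop_atTop.comp ?_
    exact tendsto_atTop_mono (fun k => Nat.le_mul_of_pos_left _ (by norm_num)) tendsto_id
  have hden : Tendsto (fun k : ℕ => (((2 * k : ℕ) : ℝ)) ^ 2) atTop atTop :=
    (tendsto_pow_atTop two_ne_zero).comp hcast
  have hlim : Tendsto (fun k : ℕ => C / (((2 * k : ℕ) : ℝ)) ^ 2) atTop (𝓝 0) :=
    tendsto_const_nhds.div_atTop hden
  -- eventually: σ_d²(k) ≤ s²/(2h²) + C/(2k)²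
  have hsub : ∀ᶠ k in atTop, dWaveOrderParamSq ψ k ≤ s ^ 2 / (2 * h ^ 2) + C / (((2 * k : ℕ) : ℝ)) ^ 2 := by
    filter_upwards [eventually_ge_atTop (max (max L₀ L₁) 1)] with k hk
    have hk0 : L₀ ≤ k := le_trans (le_trans (le_max_left _ _) (le_max_left _ _)) hk
    have hk0' : L₁ ≤ k := le_trans (le_trans (le_max_right _ _) (le_max_left _ _)) hk
    have hk1 : 1 ≤ k := le_trans (le_max_right _ _) hk
    have hL0 : L₀ ≤ 2 * k := by omega
    have hL0' : L₁ ≤ 2 * k := by omega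
    have hL1 : 1 ≤ 2 * k := by omega
    haveI : NeZero (2 * k) := ⟨by omega⟩
    rw [dWaveOrderParamSq_eq_pairFieldDensity ψ hk1]
    exact hC (2 * k) hL0 hL1 (N (2 * k)) (ψ (2 * k)) (hψ _ (even_two_mul _)).1 (hψ _ (even_two_mul _)).2
      (hslack (2 * k) hL0' (even_two_mul _) (ψ (2 * k)) (hψ _ (even_two_mul _)).1 (hψ _ (even_two_mul _)).2)
  have hbdd : IsBoundedUnder (· ≥ ·) atTop (fun k => dWaveOrderParamSq ψ k) := by
    refine ⟨0, eventually_map.2 (eventually_atTop.2 ⟨1, fun k hk => ?_⟩)⟩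
    show 0 ≤ dWaveOrderParamSq ψ k
    rw [dWaveOrderParamSq_eq_pairFieldDensity ψ hk]
    exact pairFieldDensity_nonneg _ _
  refine le_of_forall_gt_imp_ge_of_dense fun ε hε => ?_
  have hη : 0 < ε - s ^ 2 / (2 * h ^ 2) := sub_pos.2 hε
  have hev : ∀ᶠ k in atTop, dWaveOrderParamSq ψ k ≤ ε := by
    filter_upwards [hsub, hlim.eventually (eventually_le_nhds hη)] with k hk hk'
    linarith
  exact liminf_le_of_frequently_le hev.frequently hbdd

/-! ## §2 The thermodynamic-limit rows form -/

/-- **ROUTE #2 AT `t'` FROM TL ROWS.** Let `U ≥ 0`, `0 ≤ n < 2`, `h > 0`, `μ` real. Suppose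
(UPPER ROW, thermodynamic limit) `energyDensityTT' 1 t' U n ≤ e⁺`, (SOURCED LOWER ROW) `e⁻L² ≤
E₀(dWaveSourceTorusTT' L t' U μ h)` for all `L ≥ L₀`, and `s := e⁺ − μn − e⁻ > 0`. Then along EVERY sequence of
unit ground states `ψ_L` of `hubbardTorusTT' L 1 t' U` in the sectors `(rectN n L, S^z = 0)` (even sides),
`liminf_k σ_d²(2k) ≤ s²/(2h²)`. The rounding `rectN n L = 2⌊nL²/2⌋` and the passage TL row → finite tori are
absorbed by `E(rectN n L)/L² → e(1,t',U,n)` and `rectN n L/L² → n`. [cite: KomaTasaki1994, Theorem 2.2]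
[cite: Ruelle1969, §3.3] -/
theorem liminf_dWaveOrderParamSq_le_of_tlRows_TT' (t' : ℝ) {U : ℝ} (hU : 0 ≤ U) {n : ℝ} (hn0 : 0 ≤ n)
    (hn2 : n < 2) (μ : ℝ) {h : ℝ} (hh : 0 < h) {eU eL : ℝ}
    (hup : energyDensityTT' 1 t' U n ≤ eU)
    (hlo : ∃ L₀ : ℕ, ∀ (L : ℕ) [NeZero L], L₀ ≤ L → eL * (L : ℝ) ^ 2 ≤ (dWaveSourceTorusTT' L t' U μ h).groundEnergy)
    (hs : 0 < eU - μ * n - eL)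
    (ψ : ∀ L, Fock (Orb (FermionTorus 2 L)))
    (hψ : ∀ L, Even L → star (ψ L) ⬝ᵥ ψ L = 1 ∧
      IsGroundStateInSector (hubbardTorusTT' L 1 t' U) (rectN n L) 0 (ψ L)) :
    liminf (fun k => dWaveOrderParamSq ψ k) atTop ≤ (eU - μ * n - eL) ^ 2 / (2 * h ^ 2) := by
  set s := eU - μ * n - eL with hs_def
  obtain ⟨L₀, hL₀⟩ := hlo
  -- the per-site slack tends to at most `s`: for every `s' > s` it is eventually `≤ s'`
  have hE := tendsto_energyDensityTT'_torus 1 t' hU hn0 hn2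
  have hN := (tendsto_rectN_div_sq hn0).const_mul μ
  have key : ∀ s' : ℝ, s < s' → liminf (fun k => dWaveOrderParamSq ψ k) atTop ≤ s' ^ 2 / (2 * h ^ 2) := by
    intro s' hs'
    have hs'0 : 0 < s' := hs.trans hs'
    -- eventually E(rectN)/L² ≤ e + (s'-s)/2 ≤ eU + (s'-s)/2 and μ·rectN/L² ≥ μ n − (s'-s)/2
    have hδ : 0 < (s' - s) / 2 := by linarith
    have hev₁ : ∀ᶠ L : ℕ in atTop,
        groundEnergy (hubbardTorusTT' L 1 t' U) (rectN n L) / (L : ℝ) ^ 2 < eU + (s' - s) / 2 :=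
      hE.eventually (Iio_mem_nhds (by linarith))
    have hev₂ : ∀ᶠ L : ℕ in atTop, μ * n - (s' - s) / 2 < μ * ((rectN n L : ℝ) / (L : ℝ) ^ 2) :=
      hN.eventually (Ioi_mem_nhds (by linarith))
    obtain ⟨L₁, hL₁⟩ := eventually_atTop.1 (hev₁.and (hev₂.and (eventually_ge_atTop (max L₀ 1))))
    refine liminf_dWaveOrderParamSq_le_of_eventually_slack_TT' t' U μ h s' hh hs'0 (rectN n) L₁ ?_ ψ hψ
    intro L _ hL _hLe φ hφ1 hgs
    obtain ⟨h1, h2, h3⟩ := hL₁ L hL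
    have hL1 : 1 ≤ L := le_trans (le_max_right _ _) h3
    have hLL₀ : L₀ ≤ L := le_trans (le_max_left _ _) h3
    have hLpos : (0 : ℝ) < (L : ℝ) ^ 2 := by positivity
    -- sector minimum = `rectN`-particle ground energy (`S^z = 0` representative, Lieb)
    have hcard : ⌊n * (L : ℝ) ^ 2 / 2⌋₊ ≤ Fintype.card (FermionTorus 2 L) := by
      have hc : Fintype.card (FermionTorus 2 L) = L ^ 2 := by simp [FermionTorus, Fintype.card_lex]
      rw [hc]
      have : (⌊n * (L : ℝ) ^ 2 / 2⌋₊ : ℝ) ≤ n * (L : ℝ) ^ 2 / 2 := Nat.floor_le (by positivity)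
      have h' : n * (L : ℝ) ^ 2 / 2 ≤ (L : ℝ) ^ 2 := by nlinarith
      exact_mod_cast this.trans h'
    have hmin : (hubbardTorusTT' L 1 t' U).minEnergyOn (szSector (rectN n L) 0) =
        groundEnergy (hubbardTorusTT' L 1 t' U) (rectN n L) := by
      rw [rectN, groundEnergy_hubbardTorusTT'_eq_minEnergyOn_szSector L 1 t' U hcard]
    have h1' : groundEnergy (hubbardTorusTT' L 1 t' U) (rectN n L) ≤ (eU + (s' - s) / 2) * (L : ℝ) ^ 2 := by
      have := (div_lt_iff₀ hLpos).1 h1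
      exact this.le
    have h2' : (μ * n - (s' - s) / 2) * (L : ℝ) ^ 2 ≤ μ * (rectN n L : ℝ) := by
      rw [← mul_div_assoc] at h2
      exact ((lt_div_iff₀ hLpos).1 h2).le
    have h4 := hL₀ L hLL₀
    rw [hmin]
    nlinarith [h1', h2', h4]
  -- `≤ s'²/(2h²)` for every `s' > s` ⇒ `≤ s²/(2h²)`
  refine le_of_forall_gt_imp_ge_of_dense fun c hc => ?_
  have h2c : s ^ 2 < 2 * h ^ 2 * c := by
    have h2h : 0 < 2 * h ^ 2 := by positivity
    have := (div_lt_iff₀ h2h).1 hc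
    linarith
  set s' := Real.sqrt (2 * h ^ 2 * c) with hs'
  have hss' : s < s' := by
    rw [hs']
    exact Real.lt_sqrt_of_sq_lt h2c
  have hc0 : 0 ≤ 2 * h ^ 2 * c := by nlinarith [sq_nonneg s]
  have hsq : s' ^ 2 = 2 * h ^ 2 * c := by rw [hs', Real.sq_sqrt hc0]
  have := key s' hss'
  rw [hsq] at this
  have e : 2 * h ^ 2 * c / (2 * h ^ 2) = c := by field_simp
  rwa [e] at this

end Summit.HubbardSuperconductivity.HubbardLadder

end
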